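import Summits.QuantumFields.BalabanUV.Beta.GAN24.FaceWeightedLinT2
import Summits.QuantumFields.BalabanUV.Beta.GAN24.FaceReadTransportCharges
import Summits.QuantumFields.BalabanUV.Beta.GAN24.JointPeriodicCellSwap

/-!
# `BalabanUV.Beta.GAN24.FaceReadTransportStep` — binder row G-an2-4 ∕ (CONV-C), W-slot (α-0), ROW (C) AT LEVELS `≥ 1`, the OWNER's two-index pair-form tower
# (`PairFormPeriodTower.pairFormLS_tower₂`, RULING R-gan24p1-g40-1), **THE TRANSPORT ROWS AT EVERY FACE PERIOD**: the period-`P` four exit-face read of the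
# linear part `𝒜^E_j X = lin4 c G̃_j Lc X` of road-P2's E-frame comb step is a scalar multiple of the period-`Lc·P` four exit-face read of `X` ONE LEVEL DOWN —
#   `FF_P(lin4 c G̃_j Lc X)(μ,ν;α,β) = (c·K_j⁴∕2)·( FF_{Lc·P}(X)(μ,ν;α,β) + FF_{Lc·P}(Xᵀ)(μ,ν;α,β) )`,  `K_j = s_f·s_m·cH_j`, `cH_j = (stepScale_j·Lc^{d+1})⁻¹`, `Xᵀ κ u κ′ u′ = X κ′ u′ κ u`,
# for EVERY `P ≥ 1`, every level `j`, in-block root, every jointly `Lc`-covariant `LocStencil₂` table `X`, all units symbolic — so the tower's period index `m ↦ m+1` is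
# `P = Lc^m ↦ Lc^{m+1}` (road-P2 chair `b2b-balaban-gan24-p2`, gen 50; journal [GAN24P2-G50-INTENT2])

NOT IN PRINT; OUR BOOKKEEPING ([folklore] `tsum` bookkeeping BY NAME: the generic weighted engine `FaceWeightedLinT2.inner_weighted_linT2` (this gen) at `K = G̃_j` with road-P2 g41's
WEIGHTED coarse-leg charges of the co-dressed step resolvent `ChargeTowerLegs.hasSum_row_coord_inl ∕ _inr ∕ hasSum_col_coord_inl ∕ _inr` and `CoarseGaugeSourceResponse.tsum_coord_colH`
(face weight of period `P` on the coarse index ⟹ exit face of period `Lc·P` on the fine index, leaf-04 g62's `FaceWeightedSandwich.emod_mul_eq_iff`), the cell bond moved onto the lower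
table by leaf-06 g54's K4a `JointPeriodicCellSwap.sum_box_tsum_swap` (imported BY NAME), the swapped bi-vertex by an2's `KernelWardSwap.vertex2OfK_swap_eq_transpose` and leaf-04's `Lin4Additive.vertex2OfK_add`;
0 `def`, 0 cited fact, 0 `def … : Prop`, 0 sorry).  HONEST FRAMING (cell contract, verbatim): «discharging `BetaPertH` makes Bałaban's UV stability UNCONDITIONAL — a real
constructive-QFT result; it is NOT the continuum limit and NOT the Clay problem.»  HONEST DEPENDENCY (verbatim): «continuum YM on T⁴ ⇐ BetaPertH ∧ nine spine estimates (0/9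
proved); BetaPertH ⇐ (D1) ∧ (D4) ∧ CAP+tail; G-an2-4 gates asym, D1 and NE2/3/4.»

WHY.  `CombChargeTowerStepZero` (this gen) gave the period-index-`0` row of the OWNER's tower from road-P2 g36's one-step law; its lower term is the period-`Lc` face read
`Lc⁴·FF_Lc(T̃_j)`.  The rows at period index `m ≥ 1` need the face read at period `P = Lc^m` of the NEXT member `T̃_{j+1} = 𝒜^E_j T̃_j + b̃_j` (`T2RecOfUnitSplit`): the forcing's
face read `FF_P(b̃_j)` is the suppliers' (leaf-06's K6c `FourFaceSourceWords` opens it into leaf-04's three words with legs one class deeper), and the TRANSPORT term is this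
file: reading `lin4 c G̃_j Lc X` against face indicators of period `P` on its two coarse bonds and two coarse legs, each of the four readers meets a weighted coarse-leg charge of
`G̃_j` (rows ∕ columns ∕ `ℋ`-columns), which is `∓K_j` times the indicator of the exit face of period `Lc·P` one level down (`[t % Lc = Lc−1] ∧ [⌊t∕Lc⌋ % P = P−1] ↔
[t % (Lc·P) = Lc·P−1]`) — so the read lands on `FF_{Lc·P}` of the table, both slot orders (the bi-vertex is symmetrised), i.e. on `X` and on `Xᵀ`.  With the OWNER's
`FaceReadTranspose.faceRead_transpose_of_cov` (✓ p378368) the `Xᵀ` read is the bond-swapped read of `X`; the member corollary and the `LS` rows `hstep (m ≥ 1, j)` are the sequel.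
WHAT (generic `d`, cell `Lc ≥ 1`, in-block root `r ∈ box (d+1) Lc`, every `j`, units `s_f s_m` symbolic, `G̃_j := unitK s_f s_m (coDressKBmAt (toSite r) Lc (KInvStep Lc j))`):
* §1 **`lin4_eq_half_linT2_symm`** — `lin4 c K N X μ y ν y′ = (−c∕2) • linT2 K N (X + Xᵀ) μ y ν y′` (decaying `K`, bounded `X`; pointwise, unconditional otherwise).
* §2 the four WEIGHTED coarse-leg charges of `G̃_j` against the period-`P` face weight: **`hasSum_row_face_inl ∕ _inr`**, **`hasSum_col_face_inl ∕ _inr`**, **`hasSum_colH_face`**,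
  **`tsum_colH_face`** — value `∓K_j·[fine index on the exit face of period Lc·P]·[direction lock]`, `0` on multiplier legs.
* §3 **`inner_faceRead_linT2`** — for any `LocStencil₂` table `T`, POINTWISE in the cell bond: the weighted triple coarse sum of `linT2 G̃_j Lc T μ y ν ·` is
  `−K_j³·Σ_κ Σ'_u colH G̃_j Lc μ y κ u · Ψ_T(κ,u)`, `Ψ_T` the period-`Lc·P` face-masked reduced one-form of `T`.
* §4 **`faceRead_linT2`** — the cell bond summed over `box P` against its face weight (joint-periodicity swap onto `T`'s first slot, then the `ℋ`-column charge):
  `= −K_j⁴·FF_{Lc·P}(T)(μ,ν;α,β)` (nested-mask form).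
* §5 **`faceRead_lin4_coDress`** — THE TRANSPORT ROW (module docstring), conjunctive-mask form on both sides, lower reads on `X` and `Xᵀ`.
Asserts NO value and NO shape of Bałaban's tables; discharges NOTHING of (C)_{≥1} ∕ `hstep` ∕ `hSrc` ∕ `hSrcX` (kinematics of the transport only); NEVER «G-an2-4 closed» as (CONV-C);
NOT D1, NOT `BetaPertH`, NOT continuum, NOT Clay.  2026-08-24; no existing file touched.
-/

noncomputable section

open Finset
open scoped BigOperators
open Literature.MathematicalPhysics.QuantumFieldTheory
open Literature.MathematicalPhysics.QuantumFieldTheory.Balaban1983to89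
open Literature.MathematicalPhysics.QuantumFieldTheory.Balaban1983to89.Beta
open B12Sec2to5 (l1 l1_nonneg)
open ExpKernelCalculus (Site MKer Decays comp shiftK)
open OneStepResolventKernel (Fib)
open OneStepKernelFamily (KInvStep colH abs_colH_le)
open BalabanCompositeJets (LocStencil₂)
open SecondOrderResponse (vertex2OfK)
open BalabanStepJetsSucc (mmRead)
open AffineAveraging (box toSite)
open AveragingContours (blk)
open Summit.QuantumFields.BalabanUV.Beta.AxialDressingRooted (coDressKBmAt decays_coDressKBmAt_KInvStep shiftK_coDressKBmAt_KInvStep)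
open Summit.QuantumFields.BalabanUV.Beta.BorderedHessian (stepScale)
open Summit.QuantumFields.BalabanUV.Beta.HessKerDressedUnits (unitK unitK_apply legScale_inl legScale_inr colH_unitK decays_unitK)
open Summit.QuantumFields.BalabanUV.Beta.KernelWardSwap (vertex2OfK_swap_eq_transpose)
open Summit.QuantumFields.BalabanUV.Beta.GAN24.BiStencilZeroMode (Tab)
open Summit.QuantumFields.BalabanUV.Beta.GAN24.ThirdJetKernel (mmRead_smul)
open Summit.QuantumFields.BalabanUV.Beta.GAN24.T2RecursionAffine (vsym lin4 lin4_apply)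
open Summit.QuantumFields.BalabanUV.Beta.GAN24.Lin4Additive (vertex2OfK_add)
open Summit.QuantumFields.BalabanUV.Beta.GAN24.Lin4ZeroMode (bdd_of_locStencil₂)
open Summit.QuantumFields.BalabanUV.Beta.GAN24.LinT2ZeroMode (linT2 abs_le_of_locStencil₂)
open Summit.QuantumFields.BalabanUV.Beta.GAN24.LinT2ZeroModeStep (shiftK_unitK)
open Summit.QuantumFields.BalabanUV.Beta.GAN24.ZeroModeSandwich (summable_leg_mul_table)
open Summit.QuantumFields.BalabanUV.Beta.GAN24.Push4Iter (locStencil₂_swapT)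
open Summit.QuantumFields.BalabanUV.Beta.GAN24.TableDressingZeroMode (summable_ite_of_summable ite_tsum summable_triple summable_legs summable_faceSum face_shift
  faceSum_periodic)
open Summit.QuantumFields.BalabanUV.Beta.GAN24.FaceWeightedSandwich (colH_block_shift emod_mul_eq_iff)
open Summit.QuantumFields.BalabanUV.Beta.GAN24.CoarseGaugeSourceResponse (summable_bdd_mul summable_source_colH tsum_coord_colH)
open Summit.QuantumFields.BalabanUV.Beta.GAN24.ChargeTowerLegs (hasSum_row_coord_inl hasSum_row_coord_inr hasSum_col_coord_inl hasSum_col_coord_inr)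
open Summit.QuantumFields.BalabanUV.Beta.GAN24.FaceWeightedLinT2 (inner_weighted_linT2)
open Summit.QuantumFields.BalabanUV.Beta.GAN24.JointPeriodicCellSwap (sum_box_tsum_swap)
open Summit.QuantumFields.BalabanUV.Beta.GAN24.FaceReadTransportCharges (lin4_eq_half_linT2_symm abs_faceInd_le hasSum_row_face_inl hasSum_row_face_inr
  hasSum_col_face_inl hasSum_col_face_inr hasSum_colH_face tsum_colH_face locStencil₂_third ite_and₄_eq_mul ite_and₄_eq_nested nestedFace_add)

namespace Summit.QuantumFields.BalabanUV.Beta.GAN24.FaceReadTransportStep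

variable {d : ℕ}

/-! ## §3 The weighted triple coarse sum of `linT2 G̃_j Lc T`, pointwise in the cell bond -/

section Transport

variable {Lc : ℕ} [NeZero Lc] {r : Fin (d + 1) → ℕ}

/-- NOT IN PRINT; OUR BOOKKEEPING.  **THE WEIGHTED TRIPLE COARSE SUM OF THE TRANSPORT, POINTWISE IN THE CELL BOND**: for any `LocStencil₂` table `T` (`δ > 0`), every cell bond
`(μ, y)`, every `P ≥ 1`:  `Σ'_{y′} Σ'_{x′} Σ'_{z′} [y′_ν][x′_α][z′_β faces_P]·linT2 G̃_j Lc T μ y ν y′ x′ z′ (inl α)(inl β) = −K_j³·Σ_κ Σ'_u colH G̃_j Lc μ y κ u · Ψ_T(κ,u)`,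
`Ψ_T(κ,u) := Σ'_{u′} [u′_ν face_{Lc·P}]·Σ'_x Σ'_z [x_α, z_β faces_{Lc·P}]·T κ u ν u′ x z (inl α)(inl β)` (the engine `FaceWeightedLinT2.inner_weighted_linT2` at the four
charges of §2; the three Kronecker locks collapse the fibre and direction sums). -/
theorem inner_faceRead_linT2 (hLc : 1 ≤ Lc) (hr : r ∈ box (d + 1) Lc) (sf sm : ℝ) (j : ℕ) {P : ℕ} (hP : 1 ≤ P)
    {T : Tab d} {CT δT : ℝ} (hT : LocStencil₂ T CT δT) (hδT : 0 < δT)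
    (μ : Fin (d + 1)) (y : Site (d + 1)) (ν α β : Fin (d + 1)) :
    (∑' y' : Site (d + 1), ∑' x' : Site (d + 1), ∑' z' : Site (d + 1),
        (if y' ν % (P : ℤ) = (P : ℤ) - 1 then (1 : ℝ) else 0) * (if x' α % (P : ℤ) = (P : ℤ) - 1 then (1 : ℝ) else 0) * (if z' β % (P : ℤ) = (P : ℤ) - 1 then (1 : ℝ) else 0) *
          linT2 (unitK sf sm (coDressKBmAt (toSite r) Lc (KInvStep (d := d) Lc j))) Lc T μ y ν y' x' z' (Sum.inl α) (Sum.inl β))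
      = -((sf * sm * (stepScale d Lc j * (Lc : ℝ) ^ (d + 1))⁻¹) ^ 3) *
        ∑ κ : Fin (d + 1), ∑' u : Site (d + 1), colH (unitK sf sm (coDressKBmAt (toSite r) Lc (KInvStep (d := d) Lc j))) Lc μ y κ u *
          (∑' u' : Site (d + 1), (if u' ν % ((Lc * P : ℕ) : ℤ) = ((Lc * P : ℕ) : ℤ) - 1 then
            ∑' x : Site (d + 1), ∑' z : Site (d + 1), (if x α % ((Lc * P : ℕ) : ℤ) = ((Lc * P : ℕ) : ℤ) - 1 ∧ z β % ((Lc * P : ℕ) : ℤ) = ((Lc * P : ℕ) : ℤ) - 1 then T κ u ν u' x z (Sum.inl α) (Sum.inl β) else 0) else 0)) := by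
  classical
  obtain ⟨m, CK, hm, hCK, hG⟩ := decays_coDressKBmAt_KInvStep (d := d) hr j
  have hGu : Decays (unitK sf sm (coDressKBmAt (toSite r) Lc (KInvStep (d := d) Lc j))) (max |sf| |sm| * CK * max |sf| |sm|) m := decays_unitK hG
  rw [inner_weighted_linT2 (N := Lc) hGu hm hT hδT
    (φ := fun y' : Site (d + 1) => (if y' ν % (P : ℤ) = (P : ℤ) - 1 then (1 : ℝ) else 0)) (ψ₁ := fun x' : Site (d + 1) => (if x' α % (P : ℤ) = (P : ℤ) - 1 then (1 : ℝ) else 0))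
    (ψ₂ := fun z' : Site (d + 1) => (if z' β % (P : ℤ) = (P : ℤ) - 1 then (1 : ℝ) else 0))
    (fun y' => abs_faceInd_le P (y' ν)) (fun x' => abs_faceInd_le P (x' α)) (fun z' => abs_faceInd_le P (z' β)) μ y ν α β
    (ca := fun f x => Sum.elim (fun a : Fin (d + 1) => if a = α then -(sf * sm * (stepScale d Lc j * (Lc : ℝ) ^ (d + 1))⁻¹) * (if x α % ((Lc * P : ℕ) : ℤ) = ((Lc * P : ℕ) : ℤ) - 1 then (1 : ℝ) else 0) else 0) (fun _ => (0 : ℝ)) f)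
    (ch' := fun κ' u' => if κ' = ν then (sf * sm * (stepScale d Lc j * (Lc : ℝ) ^ (d + 1))⁻¹) * (if u' ν % ((Lc * P : ℕ) : ℤ) = ((Lc * P : ℕ) : ℤ) - 1 then (1 : ℝ) else 0) else 0)
    (ck := fun g z => Sum.elim (fun b : Fin (d + 1) => if b = β then (sf * sm * (stepScale d Lc j * (Lc : ℝ) ^ (d + 1))⁻¹) * (if z β % ((Lc * P : ℕ) : ℤ) = ((Lc * P : ℕ) : ℤ) - 1 then (1 : ℝ) else 0) else 0) (fun _ => (0 : ℝ)) g)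
    (fun f x => by
      cases f with
      | inl a => exact hasSum_row_face_inl hLc hr sf sm j hP α x a
      | inr m' => exact hasSum_row_face_inr hr sf sm j P α x m')
    (fun κ' u' => hasSum_colH_face hLc hr sf sm j hP ν κ' u')
    (fun g z => by
      cases g with
      | inl b => exact hasSum_col_face_inl hLc hr sf sm j hP β z b
      | inr m' => exact hasSum_col_face_inr hr sf sm j P β z m')]
  -- collapse the two fibre sums and the direction sum onto `(inl β, inl α, ν)`
  rw [Fintype.sum_sum_type]
  simp only [Sum.elim_inr, mul_zero, tsum_zero, Finset.sum_const_zero, add_zero]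
  rw [Finset.sum_eq_single β (fun b _ hb => by simp only [Sum.elim_inl, if_neg hb, mul_zero, tsum_zero, Finset.sum_const_zero])
    (fun h => absurd (Finset.mem_univ β) h)]
  rw [Fintype.sum_sum_type]
  simp only [Sum.elim_inr, zero_mul, mul_zero, tsum_zero, Finset.sum_const_zero, add_zero]
  rw [Finset.sum_eq_single α (fun a _ ha => by simp only [Sum.elim_inl, if_neg ha, zero_mul, mul_zero, tsum_zero, Finset.sum_const_zero])
    (fun h => absurd (Finset.mem_univ α) h)]
  simp only [Sum.elim_inl, if_true]
  rw [Finset.mul_sum]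
  refine Finset.sum_congr rfl fun κ _ => ?_
  rw [Finset.sum_eq_single ν (fun κ' _ hκ' => by simp only [if_neg hκ', zero_mul, mul_zero, tsum_zero])
    (fun h => absurd (Finset.mem_univ ν) h)]
  simp only [if_true]
  rw [← tsum_mul_left]
  refine tsum_congr fun u => ?_
  rw [mul_left_comm]
  congr 1
  -- the weights into the nested mask form
  have e : ∀ u' x z : Site (d + 1), T κ u ν u' x z (Sum.inl α) (Sum.inl β) *
        (-(sf * sm * (stepScale d Lc j * (Lc : ℝ) ^ (d + 1))⁻¹) * (if x α % ((Lc * P : ℕ) : ℤ) = ((Lc * P : ℕ) : ℤ) - 1 then (1 : ℝ) else 0) *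
          ((sf * sm * (stepScale d Lc j * (Lc : ℝ) ^ (d + 1))⁻¹) * (if u' ν % ((Lc * P : ℕ) : ℤ) = ((Lc * P : ℕ) : ℤ) - 1 then (1 : ℝ) else 0) *
            ((sf * sm * (stepScale d Lc j * (Lc : ℝ) ^ (d + 1))⁻¹) * (if z β % ((Lc * P : ℕ) : ℤ) = ((Lc * P : ℕ) : ℤ) - 1 then (1 : ℝ) else 0))))
      = -((sf * sm * (stepScale d Lc j * (Lc : ℝ) ^ (d + 1))⁻¹) ^ 3) *
        (if u' ν % ((Lc * P : ℕ) : ℤ) = ((Lc * P : ℕ) : ℤ) - 1 then (if x α % ((Lc * P : ℕ) : ℤ) = ((Lc * P : ℕ) : ℤ) - 1 ∧ z β % ((Lc * P : ℕ) : ℤ) = ((Lc * P : ℕ) : ℤ) - 1 then T κ u ν u' x z (Sum.inl α) (Sum.inl β) else 0) else 0) := by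
    intro u' x z
    by_cases h1 : u' ν % ((Lc * P : ℕ) : ℤ) = ((Lc * P : ℕ) : ℤ) - 1
    · by_cases h2 : x α % ((Lc * P : ℕ) : ℤ) = ((Lc * P : ℕ) : ℤ) - 1
      · by_cases h3 : z β % ((Lc * P : ℕ) : ℤ) = ((Lc * P : ℕ) : ℤ) - 1
        · rw [if_pos h1, if_pos h1, if_pos h2, if_pos h3, if_pos (And.intro h2 h3)]; ring
        · rw [if_pos h1, if_pos h1, if_neg h3, if_neg (not_and_of_not_right _ h3)]; ring
      · rw [if_pos h1, if_pos h1, if_neg h2, if_neg (not_and_of_not_left _ h2)]; ring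
    · rw [if_neg h1, if_neg h1]; ring
  simp_rw [e, tsum_mul_left]
  congr 1
  refine tsum_congr fun u' => ?_
  rw [ite_tsum]
  refine tsum_congr fun x => ?_
  rw [ite_tsum]

/-! ## §4 The cell bond over `box P`: joint-periodicity swap onto the table's first slot -/

/-- NOT IN PRINT; OUR BOOKKEEPING.  **THE FACE READ OF THE TRANSPORT OF A JOINTLY COVARIANT TABLE**: for a jointly `Lc`-covariant `LocStencil₂` table `T`, every `P ≥ 1`,
`Σ_{y ∈ box P} [y_μ face_P]·Σ'_{y′} Σ'_{x′} Σ'_{z′} [y′_ν][x′_α][z′_β faces_P]·linT2 G̃_j Lc T μ y ν y′ x′ z′ (inl α)(inl β) = −K_j⁴·Σ_{u ∈ box (Lc·P)} [u_μ face_{Lc·P}]·Ψ_T(μ,u)` — the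
period-`Lc·P` four-face read of `T` (nested-mask form), cell `box (Lc·P)` on `T`'s first slot (the cell moved from the coarse bond to the fine slot by the joint
`(P, Lc·P)`-periodicity of the summand; then §2's `ℋ`-column charge locks `κ = μ`). -/
theorem faceRead_linT2 (hLc : 1 ≤ Lc) (hr : r ∈ box (d + 1) Lc) (sf sm : ℝ) (j : ℕ) {P : ℕ} [NeZero (Lc * P)] (hP : 1 ≤ P)
    {T : Tab d} {CT δT : ℝ} (hT : LocStencil₂ T CT δT) (hδT : 0 < δT)
    (hTcov : ∀ κ u κ' u' t, T κ (u + (Lc : ℤ) • t) κ' (u' + (Lc : ℤ) • t) = shiftK (-((Lc : ℤ) • t)) (T κ u κ' u'))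
    (μ ν α β : Fin (d + 1)) :
    ∑ yy ∈ box (d + 1) P, (if toSite yy μ % (P : ℤ) = (P : ℤ) - 1 then (1 : ℝ) else 0) *
        ∑' y' : Site (d + 1), ∑' x' : Site (d + 1), ∑' z' : Site (d + 1),
          (if y' ν % (P : ℤ) = (P : ℤ) - 1 then (1 : ℝ) else 0) * (if x' α % (P : ℤ) = (P : ℤ) - 1 then (1 : ℝ) else 0) * (if z' β % (P : ℤ) = (P : ℤ) - 1 then (1 : ℝ) else 0) *
            linT2 (unitK sf sm (coDressKBmAt (toSite r) Lc (KInvStep (d := d) Lc j))) Lc T μ (toSite yy) ν y' x' z' (Sum.inl α) (Sum.inl β)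
      = -((sf * sm * (stepScale d Lc j * (Lc : ℝ) ^ (d + 1))⁻¹) ^ 4) *
        ∑ b ∈ box (d + 1) (Lc * P), (if toSite b μ % ((Lc * P : ℕ) : ℤ) = ((Lc * P : ℕ) : ℤ) - 1 then
          (∑' u' : Site (d + 1), (if u' ν % ((Lc * P : ℕ) : ℤ) = ((Lc * P : ℕ) : ℤ) - 1 then
            ∑' x : Site (d + 1), ∑' z : Site (d + 1), (if x α % ((Lc * P : ℕ) : ℤ) = ((Lc * P : ℕ) : ℤ) - 1 ∧ z β % ((Lc * P : ℕ) : ℤ) = ((Lc * P : ℕ) : ℤ) - 1 then T μ (toSite b) ν u' x z (Sum.inl α) (Sum.inl β) else 0) else 0)) else 0) := by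
  classical
  haveI : NeZero P := ⟨by omega⟩
  obtain ⟨m, CK, hm, hCK, hG⟩ := decays_coDressKBmAt_KInvStep (d := d) hr j
  have hGu : Decays (unitK sf sm (coDressKBmAt (toSite r) Lc (KInvStep (d := d) Lc j))) (max |sf| |sm| * CK * max |sf| |sm|) m := decays_unitK hG
  have hGs : ∀ t : Site (d + 1), shiftK (-((Lc : ℤ) • t)) (unitK sf sm (coDressKBmAt (toSite r) Lc (KInvStep (d := d) Lc j))) = unitK sf sm (coDressKBmAt (toSite r) Lc (KInvStep (d := d) Lc j)) := fun t => by
    rw [shiftK_unitK, shiftK_coDressKBmAt_KInvStep]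
  -- covariance at the longer period
  have hTcovM : ∀ κ u κ' u' t, T κ (u + ((Lc * P : ℕ) : ℤ) • t) κ' (u' + ((Lc * P : ℕ) : ℤ) • t)
      = shiftK (-(((Lc * P : ℕ) : ℤ) • t)) (T κ u κ' u') := by
    intro κ u κ' u' t
    have e : ((Lc * P : ℕ) : ℤ) • t = (Lc : ℤ) • ((P : ℤ) • t) := by
      funext i; simp only [Pi.smul_apply, smul_eq_mul, Nat.cast_mul]; ring
    rw [e]; exact hTcov κ u κ' u' ((P : ℤ) • t)
  -- §3 in every cell bond
  rw [Finset.sum_congr rfl (fun yy _ => by rw [inner_faceRead_linT2 hLc hr sf sm j hP hT hδT μ (toSite yy) ν α β])]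
  -- constants out, the finite direction sum out
  have e1 : ∀ yy : Fin (d + 1) → ℕ, (if toSite yy μ % (P : ℤ) = (P : ℤ) - 1 then (1 : ℝ) else 0) *
        (-((sf * sm * (stepScale d Lc j * (Lc : ℝ) ^ (d + 1))⁻¹) ^ 3) * ∑ κ : Fin (d + 1), ∑' u : Site (d + 1), colH (unitK sf sm (coDressKBmAt (toSite r) Lc (KInvStep (d := d) Lc j))) Lc μ (toSite yy) κ u * (∑' u' : Site (d + 1), (if u' ν % ((Lc * P : ℕ) : ℤ) = ((Lc * P : ℕ) : ℤ) - 1 then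
            ∑' x : Site (d + 1), ∑' z : Site (d + 1), (if x α % ((Lc * P : ℕ) : ℤ) = ((Lc * P : ℕ) : ℤ) - 1 ∧ z β % ((Lc * P : ℕ) : ℤ) = ((Lc * P : ℕ) : ℤ) - 1 then T κ u ν u' x z (Sum.inl α) (Sum.inl β) else 0) else 0)))
      = -((sf * sm * (stepScale d Lc j * (Lc : ℝ) ^ (d + 1))⁻¹) ^ 3) * ∑ κ : Fin (d + 1), ∑' u : Site (d + 1), (if toSite yy μ % (P : ℤ) = (P : ℤ) - 1 then (1 : ℝ) else 0) * (colH (unitK sf sm (coDressKBmAt (toSite r) Lc (KInvStep (d := d) Lc j))) Lc μ (toSite yy) κ u * (∑' u' : Site (d + 1), (if u' ν % ((Lc * P : ℕ) : ℤ) = ((Lc * P : ℕ) : ℤ) - 1 then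
            ∑' x : Site (d + 1), ∑' z : Site (d + 1), (if x α % ((Lc * P : ℕ) : ℤ) = ((Lc * P : ℕ) : ℤ) - 1 ∧ z β % ((Lc * P : ℕ) : ℤ) = ((Lc * P : ℕ) : ℤ) - 1 then T κ u ν u' x z (Sum.inl α) (Sum.inl β) else 0) else 0))) := by
    intro yy
    rw [mul_left_comm, Finset.mul_sum]
    simp_rw [tsum_mul_left]
  rw [Finset.sum_congr rfl (fun yy _ => e1 yy), ← Finset.mul_sum, Finset.sum_comm]
  -- the masked reduced one-form of `T` is `Lc·P`-periodic in the slot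
  have hΨper : ∀ (κ : Fin (d + 1)) (u s : Site (d + 1)), (∑' u' : Site (d + 1), (if u' ν % ((Lc * P : ℕ) : ℤ) = ((Lc * P : ℕ) : ℤ) - 1 then
            ∑' x : Site (d + 1), ∑' z : Site (d + 1), (if x α % ((Lc * P : ℕ) : ℤ) = ((Lc * P : ℕ) : ℤ) - 1 ∧ z β % ((Lc * P : ℕ) : ℤ) = ((Lc * P : ℕ) : ℤ) - 1 then T κ (u + ((Lc * P : ℕ) : ℤ) • s) ν u' x z (Sum.inl α) (Sum.inl β) else 0) else 0)) = (∑' u' : Site (d + 1), (if u' ν % ((Lc * P : ℕ) : ℤ) = ((Lc * P : ℕ) : ℤ) - 1 then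
            ∑' x : Site (d + 1), ∑' z : Site (d + 1), (if x α % ((Lc * P : ℕ) : ℤ) = ((Lc * P : ℕ) : ℤ) - 1 ∧ z β % ((Lc * P : ℕ) : ℤ) = ((Lc * P : ℕ) : ℤ) - 1 then T κ u ν u' x z (Sum.inl α) (Sum.inl β) else 0) else 0)) := fun κ u s =>
    faceSum_periodic (Lc * P) hTcovM ν α β (Sum.inl α) (Sum.inl β) κ u s
  -- summability of the cell-bond sections and of the slot sections
  have hT3 : ∀ (a b : Fib d) (κ κ' : Fin (d + 1)) (u u' x z : Site (d + 1)),
      |(if u' ν % ((Lc * P : ℕ) : ℤ) = ((Lc * P : ℕ) : ℤ) - 1 then (if x α % ((Lc * P : ℕ) : ℤ) = ((Lc * P : ℕ) : ℤ) - 1 ∧ z β % ((Lc * P : ℕ) : ℤ) = ((Lc * P : ℕ) : ℤ) - 1 then T κ u κ' u' x z a b else 0) else 0)|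
        ≤ CT * (Real.exp (-δT * l1 (u' - u)) * Real.exp (-δT * l1 (x - u)) * Real.exp (-δT * l1 (z - u))) := by
    intro a b κ κ' u u' x z
    have h0 := abs_le_of_locStencil₂ hT κ u κ' u' x z a b
    have hnn : 0 ≤ CT * (Real.exp (-δT * l1 (u' - u)) * Real.exp (-δT * l1 (x - u)) * Real.exp (-δT * l1 (z - u))) :=
      (abs_nonneg _).trans h0
    split_ifs
    · exact h0
    · rw [abs_zero]; exact hnn
    · rw [abs_zero]; exact hnn
  have hΨsum : ∀ (κ : Fin (d + 1)) (a : Site (d + 1)), Summable fun u : Site (d + 1) => colH (unitK sf sm (coDressKBmAt (toSite r) Lc (KInvStep (d := d) Lc j))) Lc μ a κ u * (∑' u' : Site (d + 1), (if u' ν % ((Lc * P : ℕ) : ℤ) = ((Lc * P : ℕ) : ℤ) - 1 then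
            ∑' x : Site (d + 1), ∑' z : Site (d + 1), (if x α % ((Lc * P : ℕ) : ℤ) = ((Lc * P : ℕ) : ℤ) - 1 ∧ z β % ((Lc * P : ℕ) : ℤ) = ((Lc * P : ℕ) : ℤ) - 1 then T κ u ν u' x z (Sum.inl α) (Sum.inl β) else 0) else 0)) := by
    intro κ a
    have h := summable_leg_mul_table (u₀ := (Lc : ℤ) • a) hm hδT (h := fun κ u => colH (unitK sf sm (coDressKBmAt (toSite r) Lc (KInvStep (d := d) Lc j))) Lc μ a κ u)
      (T := fun (f g : Fib d) (κ κ' : Fin (d + 1)) (u u' x z : Site (d + 1)) =>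
        (if u' ν % ((Lc * P : ℕ) : ℤ) = ((Lc * P : ℕ) : ℤ) - 1 then (if x α % ((Lc * P : ℕ) : ℤ) = ((Lc * P : ℕ) : ℤ) - 1 ∧ z β % ((Lc * P : ℕ) : ℤ) = ((Lc * P : ℕ) : ℤ) - 1 then T κ u κ' u' x z f g else 0) else 0))
      (fun κ u => abs_colH_le hGu μ a κ u) (fun f g κ κ' u u' x z => hT3 f g κ κ' u u' x z) (Sum.inl β) (Sum.inl α) κ ν
    refine h.congr fun u => ?_
    congr 1
    refine tsum_congr fun u' => ?_
    rw [ite_tsum]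
    refine tsum_congr fun x => ?_
    rw [ite_tsum]
  have hcol : ∀ κ (u : Site (d + 1)), Summable fun a : Site (d + 1) => colH (unitK sf sm (coDressKBmAt (toSite r) Lc (KInvStep (d := d) Lc j))) Lc μ a κ u := by
    intro κ u
    refine ((summable_source_colH (Lc := Lc) r j μ κ u).mul_left (sf * sm)).congr fun a => ?_
    rw [colH_unitK]; simp only [Pi.smul_apply, smul_eq_mul]
  -- the swap, direction by direction
  have hswap : ∀ κ : Fin (d + 1),
      ∑ yy ∈ box (d + 1) P, ∑' u : Site (d + 1), (if toSite yy μ % (P : ℤ) = (P : ℤ) - 1 then (1 : ℝ) else 0) * (colH (unitK sf sm (coDressKBmAt (toSite r) Lc (KInvStep (d := d) Lc j))) Lc μ (toSite yy) κ u * (∑' u' : Site (d + 1), (if u' ν % ((Lc * P : ℕ) : ℤ) = ((Lc * P : ℕ) : ℤ) - 1 then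
            ∑' x : Site (d + 1), ∑' z : Site (d + 1), (if x α % ((Lc * P : ℕ) : ℤ) = ((Lc * P : ℕ) : ℤ) - 1 ∧ z β % ((Lc * P : ℕ) : ℤ) = ((Lc * P : ℕ) : ℤ) - 1 then T κ u ν u' x z (Sum.inl α) (Sum.inl β) else 0) else 0)))
        = ∑ b ∈ box (d + 1) (Lc * P), ∑' a : Site (d + 1), (if a μ % (P : ℤ) = (P : ℤ) - 1 then (1 : ℝ) else 0) * (colH (unitK sf sm (coDressKBmAt (toSite r) Lc (KInvStep (d := d) Lc j))) Lc μ a κ (toSite b) * (∑' u' : Site (d + 1), (if u' ν % ((Lc * P : ℕ) : ℤ) = ((Lc * P : ℕ) : ℤ) - 1 then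
            ∑' x : Site (d + 1), ∑' z : Site (d + 1), (if x α % ((Lc * P : ℕ) : ℤ) = ((Lc * P : ℕ) : ℤ) - 1 ∧ z β % ((Lc * P : ℕ) : ℤ) = ((Lc * P : ℕ) : ℤ) - 1 then T κ (toSite b) ν u' x z (Sum.inl α) (Sum.inl β) else 0) else 0))) := by
    intro κ
    refine sum_box_tsum_swap (P := P) (Q := Lc * P)
      (fun a u => (if a μ % (P : ℤ) = (P : ℤ) - 1 then (1 : ℝ) else 0) * (colH (unitK sf sm (coDressKBmAt (toSite r) Lc (KInvStep (d := d) Lc j))) Lc μ a κ u * (∑' u' : Site (d + 1), (if u' ν % ((Lc * P : ℕ) : ℤ) = ((Lc * P : ℕ) : ℤ) - 1 then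
            ∑' x : Site (d + 1), ∑' z : Site (d + 1), (if x α % ((Lc * P : ℕ) : ℤ) = ((Lc * P : ℕ) : ℤ) - 1 ∧ z β % ((Lc * P : ℕ) : ℤ) = ((Lc * P : ℕ) : ℤ) - 1 then T κ u ν u' x z (Sum.inl α) (Sum.inl β) else 0) else 0)))) ?_ ?_ ?_
    · intro a u s
      show (if (a + (P : ℤ) • s) μ % (P : ℤ) = (P : ℤ) - 1 then (1 : ℝ) else 0) * (colH (unitK sf sm (coDressKBmAt (toSite r) Lc (KInvStep (d := d) Lc j))) Lc μ (a + (P : ℤ) • s) κ (u + ((Lc * P : ℕ) : ℤ) • s) * (∑' u' : Site (d + 1), (if u' ν % ((Lc * P : ℕ) : ℤ) = ((Lc * P : ℕ) : ℤ) - 1 then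
            ∑' x : Site (d + 1), ∑' z : Site (d + 1), (if x α % ((Lc * P : ℕ) : ℤ) = ((Lc * P : ℕ) : ℤ) - 1 ∧ z β % ((Lc * P : ℕ) : ℤ) = ((Lc * P : ℕ) : ℤ) - 1 then T κ (u + ((Lc * P : ℕ) : ℤ) • s) ν u' x z (Sum.inl α) (Sum.inl β) else 0) else 0)))
        = (if a μ % (P : ℤ) = (P : ℤ) - 1 then (1 : ℝ) else 0) * (colH (unitK sf sm (coDressKBmAt (toSite r) Lc (KInvStep (d := d) Lc j))) Lc μ a κ u * (∑' u' : Site (d + 1), (if u' ν % ((Lc * P : ℕ) : ℤ) = ((Lc * P : ℕ) : ℤ) - 1 then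
            ∑' x : Site (d + 1), ∑' z : Site (d + 1), (if x α % ((Lc * P : ℕ) : ℤ) = ((Lc * P : ℕ) : ℤ) - 1 ∧ z β % ((Lc * P : ℕ) : ℤ) = ((Lc * P : ℕ) : ℤ) - 1 then T κ u ν u' x z (Sum.inl α) (Sum.inl β) else 0) else 0)))
      have e2 : u + ((Lc * P : ℕ) : ℤ) • s = (Lc : ℤ) • ((P : ℤ) • s) + u := by
        funext i; simp only [Pi.add_apply, Pi.smul_apply, smul_eq_mul, Nat.cast_mul]; ring
      rw [face_shift P a s μ, hΨper κ u s, e2, colH_block_shift hGs μ κ (a + (P : ℤ) • s) ((P : ℤ) • s) u, add_sub_cancel_right]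
    · intro a
      exact (hΨsum κ a).mul_left _
    · intro u
      exact summable_bdd_mul ((hcol κ u).mul_right ((∑' u' : Site (d + 1), (if u' ν % ((Lc * P : ℕ) : ℤ) = ((Lc * P : ℕ) : ℤ) - 1 then
            ∑' x : Site (d + 1), ∑' z : Site (d + 1), (if x α % ((Lc * P : ℕ) : ℤ) = ((Lc * P : ℕ) : ℤ) - 1 ∧ z β % ((Lc * P : ℕ) : ℤ) = ((Lc * P : ℕ) : ℤ) - 1 then T κ u ν u' x z (Sum.inl α) (Sum.inl β) else 0) else 0)))) (fun a : Site (d + 1) => abs_faceInd_le P (a μ))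
  simp_rw [hswap]
  -- the `ℋ`-column charge locks `κ = μ`
  have hinner : ∀ (κ : Fin (d + 1)) (b : Fin (d + 1) → ℕ),
      (∑' a : Site (d + 1), (if a μ % (P : ℤ) = (P : ℤ) - 1 then (1 : ℝ) else 0) * (colH (unitK sf sm (coDressKBmAt (toSite r) Lc (KInvStep (d := d) Lc j))) Lc μ a κ (toSite b) * (∑' u' : Site (d + 1), (if u' ν % ((Lc * P : ℕ) : ℤ) = ((Lc * P : ℕ) : ℤ) - 1 then
            ∑' x : Site (d + 1), ∑' z : Site (d + 1), (if x α % ((Lc * P : ℕ) : ℤ) = ((Lc * P : ℕ) : ℤ) - 1 ∧ z β % ((Lc * P : ℕ) : ℤ) = ((Lc * P : ℕ) : ℤ) - 1 then T κ (toSite b) ν u' x z (Sum.inl α) (Sum.inl β) else 0) else 0))))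
        = (if κ = μ then (sf * sm * (stepScale d Lc j * (Lc : ℝ) ^ (d + 1))⁻¹) * (if toSite b μ % ((Lc * P : ℕ) : ℤ) = ((Lc * P : ℕ) : ℤ) - 1 then (1 : ℝ) else 0) else 0) * (∑' u' : Site (d + 1), (if u' ν % ((Lc * P : ℕ) : ℤ) = ((Lc * P : ℕ) : ℤ) - 1 then
            ∑' x : Site (d + 1), ∑' z : Site (d + 1), (if x α % ((Lc * P : ℕ) : ℤ) = ((Lc * P : ℕ) : ℤ) - 1 ∧ z β % ((Lc * P : ℕ) : ℤ) = ((Lc * P : ℕ) : ℤ) - 1 then T κ (toSite b) ν u' x z (Sum.inl α) (Sum.inl β) else 0) else 0)) := by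
    intro κ b
    have e3 : ∀ a : Site (d + 1), (if a μ % (P : ℤ) = (P : ℤ) - 1 then (1 : ℝ) else 0) * (colH (unitK sf sm (coDressKBmAt (toSite r) Lc (KInvStep (d := d) Lc j))) Lc μ a κ (toSite b) * (∑' u' : Site (d + 1), (if u' ν % ((Lc * P : ℕ) : ℤ) = ((Lc * P : ℕ) : ℤ) - 1 then
            ∑' x : Site (d + 1), ∑' z : Site (d + 1), (if x α % ((Lc * P : ℕ) : ℤ) = ((Lc * P : ℕ) : ℤ) - 1 ∧ z β % ((Lc * P : ℕ) : ℤ) = ((Lc * P : ℕ) : ℤ) - 1 then T κ (toSite b) ν u' x z (Sum.inl α) (Sum.inl β) else 0) else 0)))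
        = ((if a μ % (P : ℤ) = (P : ℤ) - 1 then (1 : ℝ) else 0) * colH (unitK sf sm (coDressKBmAt (toSite r) Lc (KInvStep (d := d) Lc j))) Lc μ a κ (toSite b)) * (∑' u' : Site (d + 1), (if u' ν % ((Lc * P : ℕ) : ℤ) = ((Lc * P : ℕ) : ℤ) - 1 then
            ∑' x : Site (d + 1), ∑' z : Site (d + 1), (if x α % ((Lc * P : ℕ) : ℤ) = ((Lc * P : ℕ) : ℤ) - 1 ∧ z β % ((Lc * P : ℕ) : ℤ) = ((Lc * P : ℕ) : ℤ) - 1 then T κ (toSite b) ν u' x z (Sum.inl α) (Sum.inl β) else 0) else 0)) := fun a => by ring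
    simp_rw [e3]
    rw [tsum_mul_right, tsum_colH_face hLc hr sf sm j hP μ κ (toSite b)]
  simp_rw [hinner]
  rw [Finset.sum_eq_single μ (fun κ _ hκ => by simp only [if_neg hκ, zero_mul, Finset.sum_const_zero]) (fun h => absurd (Finset.mem_univ μ) h)]
  simp only [if_true]
  rw [Finset.mul_sum, Finset.mul_sum]
  refine Finset.sum_congr rfl fun b _ => ?_
  by_cases hb : toSite b μ % ((Lc * P : ℕ) : ℤ) = ((Lc * P : ℕ) : ℤ) - 1
  · rw [if_pos hb, if_pos hb]; ring
  · rw [if_neg hb, if_neg hb]; ring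


/-! ## §5 The transport row: the face read of the linear part of the E-frame step -/

/-- NOT IN PRINT; OUR BOOKKEEPING.  **THE TRANSPORT ROW AT EVERY FACE PERIOD** (module docstring): for every `P ≥ 1`, every level `j`, in-block root, units `s_f s_m` and the
scalar `c` symbolic, and every jointly `Lc`-covariant `LocStencil₂` table `X` (`δ > 0`), the period-`P` four exit-face read (bonds outside, legs inside, ONE conjunctive mask, cell
`box P` on the first bond — the currency of `T2RecChargeStepFourFace.zmode_succ_eq_fourFace` and of the OWNER's `PairFormPeriodTowerBase`) of the linear part
`lin4 c G̃_j Lc X` is `(c·K_j⁴∕2)·(FF_{Lc·P}(X)(μ,ν;α,β) + FF_{Lc·P}(Xᵀ)(μ,ν;α,β))`, `K_j = s_f s_m (stepScale_j·Lc^{d+1})⁻¹` — the period-`Lc·P` four exit-face reads of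
`X` and of its slot transpose ONE LEVEL DOWN (cell `box (Lc·P)`).  With `FaceReadTranspose.faceRead_transpose_of_cov` the second read is the bond-swapped read of `X`. -/
theorem faceRead_lin4_coDress (hLc : 1 ≤ Lc) (hr : r ∈ box (d + 1) Lc) (sf sm c : ℝ) (j : ℕ) {P : ℕ} [NeZero (Lc * P)] (hP : 1 ≤ P)
    {X : Tab d} {C δ : ℝ} (hX : LocStencil₂ X C δ) (hδ : 0 < δ)
    (hXcov : ∀ κ u κ' u' t, X κ (u + (Lc : ℤ) • t) κ' (u' + (Lc : ℤ) • t) = shiftK (-((Lc : ℤ) • t)) (X κ u κ' u'))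
    (μ ν α β : Fin (d + 1)) :
    ∑ yy ∈ box (d + 1) P, ∑' y' : Site (d + 1), ∑' x' : Site (d + 1), ∑' z' : Site (d + 1),
        (if toSite yy μ % (P : ℤ) = (P : ℤ) - 1 ∧ y' ν % (P : ℤ) = (P : ℤ) - 1 ∧ x' α % (P : ℤ) = (P : ℤ) - 1 ∧ z' β % (P : ℤ) = (P : ℤ) - 1 then
          lin4 c (unitK sf sm (coDressKBmAt (toSite r) Lc (KInvStep (d := d) Lc j))) Lc X μ (toSite yy) ν y' x' z' (Sum.inl α) (Sum.inl β) else 0)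
      = (c * (sf * sm * (stepScale d Lc j * (Lc : ℝ) ^ (d + 1))⁻¹) ^ 4 / 2) *
        ( (∑ b ∈ box (d + 1) (Lc * P), ∑' u' : Site (d + 1), ∑' x : Site (d + 1), ∑' z : Site (d + 1),
            (if toSite b μ % ((Lc * P : ℕ) : ℤ) = ((Lc * P : ℕ) : ℤ) - 1 ∧ u' ν % ((Lc * P : ℕ) : ℤ) = ((Lc * P : ℕ) : ℤ) - 1 ∧ x α % ((Lc * P : ℕ) : ℤ) = ((Lc * P : ℕ) : ℤ) - 1 ∧ z β % ((Lc * P : ℕ) : ℤ) = ((Lc * P : ℕ) : ℤ) - 1 then X μ (toSite b) ν u' x z (Sum.inl α) (Sum.inl β) else 0))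
        + (∑ b ∈ box (d + 1) (Lc * P), ∑' u' : Site (d + 1), ∑' x : Site (d + 1), ∑' z : Site (d + 1),
            (if toSite b μ % ((Lc * P : ℕ) : ℤ) = ((Lc * P : ℕ) : ℤ) - 1 ∧ u' ν % ((Lc * P : ℕ) : ℤ) = ((Lc * P : ℕ) : ℤ) - 1 ∧ x α % ((Lc * P : ℕ) : ℤ) = ((Lc * P : ℕ) : ℤ) - 1 ∧ z β % ((Lc * P : ℕ) : ℤ) = ((Lc * P : ℕ) : ℤ) - 1 then X ν u' μ (toSite b) x z (Sum.inl α) (Sum.inl β) else 0)) ) := by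
  classical
  haveI : NeZero P := ⟨by omega⟩
  obtain ⟨m, CK, hm, hCK, hG⟩ := decays_coDressKBmAt_KInvStep (d := d) hr j
  have hGu : Decays (unitK sf sm (coDressKBmAt (toSite r) Lc (KInvStep (d := d) Lc j))) (max |sf| |sm| * CK * max |sf| |sm|) m := decays_unitK hG
  have hXb : ∀ κ u κ' u' x z a b, |X κ u κ' u' x z a b| ≤ C := fun κ u κ' u' x z a b => bdd_of_locStencil₂ hX hδ.le κ u κ' u' x z a b
  -- the slot-symmetrised table: `LocStencil₂` at a third of the rate, jointly covariant
  have hδ3 : 0 < δ / 3 := by positivity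
  have hXT : LocStencil₂ (fun κ u κ' u' => X κ' u' κ u) C (δ / 3) := locStencil₂_swapT hX hδ.le
  have hXS : LocStencil₂ (X + fun κ u κ' u' => X κ' u' κ u) (C + C) (δ / 3) :=
    BalabanStepW2.locStencil₂_add' (locStencil₂_third hX hδ.le) hXT
  have hXScov : ∀ κ u κ' u' t, (X + fun κ u κ' u' => X κ' u' κ u) κ (u + (Lc : ℤ) • t) κ' (u' + (Lc : ℤ) • t)
      = shiftK (-((Lc : ℤ) • t)) ((X + fun κ u κ' u' => X κ' u' κ u) κ u κ' u') := by
    intro κ u κ' u' t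
    show X κ (u + (Lc : ℤ) • t) κ' (u' + (Lc : ℤ) • t) + X κ' (u' + (Lc : ℤ) • t) κ (u + (Lc : ℤ) • t)
      = shiftK (-((Lc : ℤ) • t)) (X κ u κ' u' + X κ' u' κ u)
    rw [hXcov κ u κ' u' t, hXcov κ' u' κ u t]
    funext x z a b
    simp only [shiftK, Pi.add_apply]
  -- the summand: conjunctive mask as weights, `lin4` as `(−c∕2)·linT2` of the symmetrised table
  have e4 : ∀ (yy : Fin (d + 1) → ℕ) (y' x' z' : Site (d + 1)),
      (if toSite yy μ % (P : ℤ) = (P : ℤ) - 1 ∧ y' ν % (P : ℤ) = (P : ℤ) - 1 ∧ x' α % (P : ℤ) = (P : ℤ) - 1 ∧ z' β % (P : ℤ) = (P : ℤ) - 1 then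
          lin4 c (unitK sf sm (coDressKBmAt (toSite r) Lc (KInvStep (d := d) Lc j))) Lc X μ (toSite yy) ν y' x' z' (Sum.inl α) (Sum.inl β) else 0)
        = (-(c * (1 / 2 : ℝ))) * ((if toSite yy μ % (P : ℤ) = (P : ℤ) - 1 then (1 : ℝ) else 0) *
            ((if y' ν % (P : ℤ) = (P : ℤ) - 1 then (1 : ℝ) else 0) * (if x' α % (P : ℤ) = (P : ℤ) - 1 then (1 : ℝ) else 0) * (if z' β % (P : ℤ) = (P : ℤ) - 1 then (1 : ℝ) else 0) *
              linT2 (unitK sf sm (coDressKBmAt (toSite r) Lc (KInvStep (d := d) Lc j))) Lc (X + fun κ u κ' u' => X κ' u' κ u) μ (toSite yy) ν y' x' z' (Sum.inl α) (Sum.inl β))) := by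
    intro yy y' x' z'
    rw [ite_and₄_eq_mul, lin4_eq_half_linT2_symm hGu hm c Lc hXb μ (toSite yy) ν y']
    simp only [Pi.smul_apply, smul_eq_mul]
    ring
  simp_rw [e4, tsum_mul_left]
  rw [← Finset.mul_sum, faceRead_linT2 hLc hr sf sm j hP hXS hδ3 hXScov μ ν α β]
  -- split the symmetrised read into the reads of `X` and of `Xᵀ`, then back to the conjunctive mask
  have esplit : ∀ b : Fin (d + 1) → ℕ,
      (if toSite b μ % ((Lc * P : ℕ) : ℤ) = ((Lc * P : ℕ) : ℤ) - 1 then (∑' u' : Site (d + 1), (if u' ν % ((Lc * P : ℕ) : ℤ) = ((Lc * P : ℕ) : ℤ) - 1 then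
            ∑' x : Site (d + 1), ∑' z : Site (d + 1), (if x α % ((Lc * P : ℕ) : ℤ) = ((Lc * P : ℕ) : ℤ) - 1 ∧ z β % ((Lc * P : ℕ) : ℤ) = ((Lc * P : ℕ) : ℤ) - 1 then (X + fun κ u κ' u' => X κ' u' κ u) μ (toSite b) ν u' x z (Sum.inl α) (Sum.inl β) else 0) else 0)) else 0)
        = (if toSite b μ % ((Lc * P : ℕ) : ℤ) = ((Lc * P : ℕ) : ℤ) - 1 then (∑' u' : Site (d + 1), (if u' ν % ((Lc * P : ℕ) : ℤ) = ((Lc * P : ℕ) : ℤ) - 1 then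
            ∑' x : Site (d + 1), ∑' z : Site (d + 1), (if x α % ((Lc * P : ℕ) : ℤ) = ((Lc * P : ℕ) : ℤ) - 1 ∧ z β % ((Lc * P : ℕ) : ℤ) = ((Lc * P : ℕ) : ℤ) - 1 then X μ (toSite b) ν u' x z (Sum.inl α) (Sum.inl β) else 0) else 0)) else 0) + (if toSite b μ % ((Lc * P : ℕ) : ℤ) = ((Lc * P : ℕ) : ℤ) - 1 then (∑' u' : Site (d + 1), (if u' ν % ((Lc * P : ℕ) : ℤ) = ((Lc * P : ℕ) : ℤ) - 1 then
            ∑' x : Site (d + 1), ∑' z : Site (d + 1), (if x α % ((Lc * P : ℕ) : ℤ) = ((Lc * P : ℕ) : ℤ) - 1 ∧ z β % ((Lc * P : ℕ) : ℤ) = ((Lc * P : ℕ) : ℤ) - 1 then (fun κ u κ' u' => X κ' u' κ u) μ (toSite b) ν u' x z (Sum.inl α) (Sum.inl β) else 0) else 0)) else 0) := by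
    intro b
    by_cases hb : toSite b μ % ((Lc * P : ℕ) : ℤ) = ((Lc * P : ℕ) : ℤ) - 1
    · simp only [if_pos hb, Pi.add_apply]
      exact nestedFace_add (M := ((Lc * P : ℕ) : ℤ)) hX hδ hXT hδ3 μ (toSite b) ν α β
    · simp only [if_neg hb, add_zero]
  simp_rw [esplit]
  rw [Finset.sum_add_distrib]
  have enest : ∀ (v : Site (d + 1) → Site (d + 1) → Site (d + 1) → ℝ) (b : Fin (d + 1) → ℕ),
      (∑' u' : Site (d + 1), ∑' x : Site (d + 1), ∑' z : Site (d + 1), (if toSite b μ % ((Lc * P : ℕ) : ℤ) = ((Lc * P : ℕ) : ℤ) - 1 ∧ u' ν % ((Lc * P : ℕ) : ℤ) = ((Lc * P : ℕ) : ℤ) - 1 ∧ x α % ((Lc * P : ℕ) : ℤ) = ((Lc * P : ℕ) : ℤ) - 1 ∧ z β % ((Lc * P : ℕ) : ℤ) = ((Lc * P : ℕ) : ℤ) - 1 then v u' x z else 0))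
        = (if toSite b μ % ((Lc * P : ℕ) : ℤ) = ((Lc * P : ℕ) : ℤ) - 1 then (∑' u' : Site (d + 1), (if u' ν % ((Lc * P : ℕ) : ℤ) = ((Lc * P : ℕ) : ℤ) - 1 then
            ∑' x : Site (d + 1), ∑' z : Site (d + 1), (if x α % ((Lc * P : ℕ) : ℤ) = ((Lc * P : ℕ) : ℤ) - 1 ∧ z β % ((Lc * P : ℕ) : ℤ) = ((Lc * P : ℕ) : ℤ) - 1 then v u' x z else 0) else 0)) else 0) := by
    intro v b
    rw [ite_tsum]
    refine tsum_congr fun u' => ?_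
    rw [ite_tsum, ite_tsum]
    refine tsum_congr fun x => ?_
    rw [ite_tsum, ite_tsum]
    refine tsum_congr fun z => ?_
    rw [ite_and₄_eq_nested]
  simp_rw [enest (fun u' x z => X μ (toSite _) ν u' x z (Sum.inl α) (Sum.inl β))]
  rw [Finset.sum_congr rfl (fun b _ => enest (fun u' x z => X ν u' μ (toSite b) x z (Sum.inl α) (Sum.inl β)) b)]
  ring

end Transport

end Summit.QuantumFields.BalabanUV.Beta.GAN24.FaceReadTransportStep

end
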